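import Summits.QuantumFields.YangMills.Theses.FibreConvexityTail
import Literature.MathematicalPhysics.QuantumFieldTheory.Balaban1983to89.T3HistoryTailReduction
import Literature.MathematicalPhysics.QuantumFieldTheory.Balaban1983to89.T3AveragedTailProfile

/-!
# Route `FibreConvexityTail` (QuantumFields / YangMills; rung-R3 leaf `T3YM3TorusStatement.YM3TorusSU2`) — THE GLUE
# `HistoryTailOfTwoSided` (support item stmt-QuantumFields-25569), PROVED

WHAT THIS IS NOT: not a proof of the route's cruxes `TwoSidedTailL` (stmt-QuantumFields-25567, the fibre-convexity lever) or
`TowerTailL` (stmt-QuantumFields-25568, the tower residual), nor of the parent route's residual cruxes; no large-field estimate is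
proved here, nothing bears on the Yang–Mills mass gap, and the rung R3 (`YM3TorusSU2`, a RECORD rung, not the Clay statement) stays
open.  It is the route's provable bookkeeping: the two finest-bad-level tails `TwoSidedTailL` (conditioner two levels up SMALL) and
`TowerTailL` (conditioner LARGE somewhere) together give the body of the parent crux `UnitScaleTilt.HistoryTailL`
(stmt-QuantumFields-19936) — `T3UnitScaleTilt.HistoryTailAt F γ b₀ p₀ m` for every volume-free top fraction `1/m`, `m ≥ 1`.

THE ARGUMENT.
§1 FINEST-BAD-LEVEL DECOMPOSITION (any gauge group, any averaging, any thresholds): a fine field outside Bałaban's UV-small-history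
   event `histGood K n` ([Balaban1985UV3] (7) p.257) has a LEAST height `j ≤ K − n` whose block-averaged field `Ū^{j}` is not
   `θ(K−j)`-small (`Nat.find`), and then every finer height `i < j` IS `θ(K−i)`-small:
   `(histGood K n)ᶜ ⊆ ⋃_{j ≤ K−n} ({¬PlaqSmall θ(K−j) (Ū^{j})} ∩ {∀ i < j, PlaqSmall θ(K−i) (Ū^{i})})`, with its union bound
   (`real_compl_histGood_le_sum_finestBad`).  The `j = 0` term is the BARE large-field event of the finest lattice.
§2 ONE HEIGHT SPLITS OVER PLAQUETTES AND BY THE CONDITIONER (pure measure theory): `{¬PlaqSmall θ (Φ y)} ∩ B ⊆ ⋃_a ({θ ≤ |Φ(y)(∂a) − 1|}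
   ∩ B)`, and each plaquette term is split by an arbitrary predicate `c` (here: «the conditioner `Ū^{j+2}` is `θ(K−j−2)`-small»)
   into the (T)-event `∩ {c}` and the (W)-event `∩ {¬c}` (`real_not_plaqSmall_inter_le_sum_split`).
§3 THE REDUCTION (`historyTailAt_of_bare_finestBad`): a summable bare profile `q₀` (`Gibbs_K{¬PlaqSmall θ(K)} ≤ q₀ K`) and a profile `q`
   with summable tail sums bounding the finest-bad-level events for `1 ≤ j`, `j + 2 ≤ K` by `q(K−j)` give `HistoryTailAt F γ b₀ p₀ m`
   for every `m ≥ 1`, with `w_K = 𝟙[K < 2m] + q₀ K + q₀ (K+1) + Σ'_t q(t + ⌊K/m⌋)`: for `K ≥ 2m` the free top fraction `n = ⌊K/m⌋ ≥ 2`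
   keeps every constrained averaged height `j ≤ K − n` (run `K`) resp. `j ≤ K + 1 − n` (run `K+1`) two levels below the top, so the
   conditioner exists; for `K < 2m` the bound `1` is used (finitely many `K`).  Summability: `T3HistoryTailReduction.summable_comp_div`
   (the free fraction costs a factor `m`).
§4 THE ITEM: `b₀ = max b₁ (max bmin_T (max bmin_W 1))`, `p₀ = max p₁ 3`, `γ₁ = min γ_T γ_W ≤ 1`; the bare profile is the tree theorem
   `T3BareTailProfile.bareTailAt` (reflection positivity + chessboard, landed), the per-height arithmetic
   `#Plaq_j · Cβ_{K−j}^A e^{−c p(g_{K−j})²} ≤ A'·2^{−(K−j)}` is the tree's `T3AveragedTailProfile.perHeight_bound`, applied once to the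
   (T)-constants and once to the (W)-constants.

References: T. Bałaban, CMP 102 (1985) 255–275 [Balaban1985UV3] ((7) p.257, (71) p.273); J. Fröhlich, R. Israel, E. Lieb, B. Simon,
CMP 62 (1978) 1–34 [FrohlichIsraelLiebSimon1978] (chessboard estimate behind the bare term).
-/

noncomputable section

open MeasureTheory Filter Topology
open Literature.MathematicalPhysics.QuantumFieldTheory.Balaban1983to89
open Literature.MathematicalPhysics.QuantumFieldTheory.Balaban1983to89.Missing
open Literature.MathematicalPhysics.QuantumFieldTheory.Balaban1983to89.T4Continuum
open Literature.MathematicalPhysics.QuantumFieldTheory.Balaban1983to89.T3ContinuumYM3Torus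
open Literature.MathematicalPhysics.QuantumFieldTheory.Balaban1983to89.T3UnitScaleTilt
open Literature.MathematicalPhysics.QuantumFieldTheory.Balaban1983to89.T3UnitLawDensityEML (ℰp measurableE_ℰp)
open Literature.MathematicalPhysics.QuantumFieldTheory.Balaban1983to89.T3HistoryTailReduction
open Literature.MathematicalPhysics.QuantumFieldTheory.Balaban1983to89.T3CruxEstimates
open Literature.MathematicalPhysics.QuantumFieldTheory.Balaban1983to89.T3BareTailProfile
open Literature.MathematicalPhysics.QuantumFieldTheory.Balaban1983to89.T3AveragedTailProfile

namespace Summit.QuantumFields.YangMills.Theorems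

namespace HistoryTailOfTwoSided

/-! ## §1 The finest-bad-level decomposition of the complement of Bałaban's UV-small-history event -/

section FinestBadLevel

variable (F : T3Family) {G : Type*} [GaugeGroup G] [MeasurableSpace G] (ℰ : LoopAverage G)

omit [MeasurableSpace G] in
/-- **FINEST-BAD-LEVEL DECOMPOSITION**: a fine field outside the UV-small-history event `histGood K n` has a least height
`j ≤ K − n` at which the block-averaged field is not `θ(K−j)`-small, and all finer heights `i < j` are then `θ(K−i)`-small:
`(histGood K n)ᶜ ⊆ ⋃_{j < K−n+1} ({¬PlaqSmall θ(K−j) (Ū^{j})} ∩ {∀ i < j, PlaqSmall θ(K−i) (Ū^{i})})` (Bałaban's decomposition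
of unity [Balaban1985UV3] (7) p.257 organised by the first large scale). -/
theorem compl_histGood_subset_iUnion_finestBad (θ : ℕ → ℝ) (K n : ℕ) :
    (histGood F ℰ θ K n)ᶜ ⊆ ⋃ j ∈ Finset.range (K - n + 1),
      ({U | ¬ PlaqSmall (θ (K - j)) (Averaging.iter (fun i => BlockAveraging.blockAvg (P := F.P K) (j := i) ℰ) j U)} ∩
        {U | ∀ i, i < j →
          PlaqSmall (θ (K - i)) (Averaging.iter (fun i' => BlockAveraging.blockAvg (P := F.P K) (j := i') ℰ) i U)}) := by
  classical
  intro U hU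
  simp only [histGood, Set.mem_compl_iff, Set.mem_setOf_eq, not_forall] at hU
  obtain ⟨j, hj, hbad⟩ := hU
  have hex : ∃ j, j + n ≤ K ∧
      ¬ PlaqSmall (θ (K - j)) (Averaging.iter (fun i => BlockAveraging.blockAvg (P := F.P K) (j := i) ℰ) j U) :=
    ⟨j, hj, hbad⟩
  obtain ⟨hj₀n, hj₀bad⟩ := Nat.find_spec hex
  simp only [Set.mem_iUnion, Set.mem_inter_iff, Set.mem_setOf_eq, Finset.mem_range]
  refine ⟨Nat.find hex, by omega, hj₀bad, fun i hi => ?_⟩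
  by_contra hcon
  exact Nat.find_min hex hi ⟨by omega, hcon⟩

/-- **THE FINEST-BAD-LEVEL UNION BOUND**: for every finite measure `μ` on the fine fields of the `K`-th approximation,
`μ((histGood K n)ᶜ) ≤ Σ_{j < K−n+1} μ({¬PlaqSmall θ(K−j) (Ū^{j})} ∩ {∀ i < j, PlaqSmall θ(K−i) (Ū^{i})})`. -/
theorem real_compl_histGood_le_sum_finestBad (θ : ℕ → ℝ) (K n : ℕ) (μ : Measure (GaugeField (F.P K) 0 G))
    [IsFiniteMeasure μ] :
    μ.real (histGood F ℰ θ K n)ᶜ ≤ ∑ j ∈ Finset.range (K - n + 1),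
      μ.real ({U | ¬ PlaqSmall (θ (K - j)) (Averaging.iter (fun i => BlockAveraging.blockAvg (P := F.P K) (j := i) ℰ) j U)} ∩
        {U | ∀ i, i < j →
          PlaqSmall (θ (K - i)) (Averaging.iter (fun i' => BlockAveraging.blockAvg (P := F.P K) (j := i') ℰ) i U)}) :=
  (measureReal_mono (compl_histGood_subset_iUnion_finestBad F ℰ θ K n) (measure_ne_top _ _)).trans
    (measureReal_biUnion_finset_le _ _)

end FinestBadLevel

/-! ## §2 One height: union over plaquettes, split by an arbitrary conditioner predicate -/

section Split

variable {G : Type*} [GaugeGroup G]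

/-- **ONE HEIGHT SPLITS OVER PLAQUETTES AND BY THE CONDITIONER**: for a finite measure `μ`, any map `Φ` to height-`j` fields (e.g.
the `j`-fold block averaging), any event `B` (e.g. «all finer heights small») and any predicate `c` (e.g. «the conditioner two
levels up is small»): `μ({¬PlaqSmall θ (Φ y)} ∩ B) ≤ Σ_a [μ({θ ≤ |Φ(y)(∂a) − 1|} ∩ B ∩ {c}) + μ({θ ≤ |Φ(y)(∂a) − 1|} ∩ B ∩ {¬c})]`
— the union bound over plaquettes followed by the two-case split. -/
theorem real_not_plaqSmall_inter_le_sum_split {Y : Type*} [MeasurableSpace Y] (μ : Measure Y) [IsFiniteMeasure μ]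
    {P : Params} {j : ℕ} (Φ : Y → GaugeField P j G) (θ : ℝ) (B : Set Y) (c : Y → Prop) :
    μ.real ({y | ¬ PlaqSmall θ (Φ y)} ∩ B) ≤
      ∑ a : Plaq P j, (μ.real ({y | θ ≤ GaugeGroup.dist1 (GaugeField.plaqHol (Φ y) a)} ∩ B ∩ {y | c y}) +
        μ.real ({y | θ ≤ GaugeGroup.dist1 (GaugeField.plaqHol (Φ y) a)} ∩ B ∩ {y | ¬ c y})) := by
  have hset : {y | ¬ PlaqSmall θ (Φ y)} ∩ B ⊆
      ⋃ a : Plaq P j, ({y | θ ≤ GaugeGroup.dist1 (GaugeField.plaqHol (Φ y) a)} ∩ B) := by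
    intro y hy
    obtain ⟨h1, h2⟩ := hy
    simp only [PlaqSmall, Set.mem_setOf_eq, not_forall, not_lt] at h1
    obtain ⟨a, ha⟩ := h1
    exact Set.mem_iUnion.mpr ⟨a, ha, h2⟩
  refine (measureReal_mono hset (measure_ne_top _ _)).trans ((measureReal_iUnion_fintype_le _).trans ?_)
  refine Finset.sum_le_sum fun a _ => ?_
  have hsplit : {y | θ ≤ GaugeGroup.dist1 (GaugeField.plaqHol (Φ y) a)} ∩ B ⊆
      ({y | θ ≤ GaugeGroup.dist1 (GaugeField.plaqHol (Φ y) a)} ∩ B ∩ {y | c y}) ∪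
        ({y | θ ≤ GaugeGroup.dist1 (GaugeField.plaqHol (Φ y) a)} ∩ B ∩ {y | ¬ c y}) := by
    intro y hy
    by_cases hc : c y
    · exact Or.inl ⟨hy, hc⟩
    · exact Or.inr ⟨hy, hc⟩
  exact (measureReal_mono hsplit (measure_ne_top _ _)).trans (measureReal_union_le _ _)

end Split

/-! ## §3 The reduction: bare profile + finest-bad-level profile ⇒ `HistoryTailAt` for every `m ≥ 1` -/

section Reduction

/-- **`HistoryTailAt` FROM A BARE PROFILE AND A FINEST-BAD-LEVEL PROFILE** (`SU(2)`, printed smearing, `γ ≥ 0`, `m ≥ 1`): a summable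
`q₀ ≥ 0` with `Gibbs_K{¬PlaqSmall θ(K)} ≤ q₀ K` (the bare finest-lattice term) and a `q ≥ 0` with `Σ q`, `Σ_n Σ'_t q(t+n) < ∞` bounding,
for every `K` and every height `1 ≤ j`, `j + 2 ≤ K`, the finest-bad-level event `{¬PlaqSmall θ(K−j) (Ū^{j})} ∩ {∀ i < j, PlaqSmall
θ(K−i) (Ū^{i})}` by `q(K−j)`, give `HistoryTailAt F γ b₀ p₀ m` with `w_K = 𝟙[K < 2m] + q₀ K + q₀ (K+1) + Σ'_t q(t + ⌊K/m⌋)` — for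
`K ≥ 2m` the free top fraction `⌊K/m⌋ ≥ 2` keeps every constrained averaged height two levels below the top of both runs. -/
theorem historyTailAt_of_bare_finestBad (F : T3Family) {γ : ℝ} (hγ : 0 ≤ γ) (b₀ p₀ : ℝ) {m : ℕ} (hm : 0 < m)
    (q₀ q : ℕ → ℝ) (hq₀0 : ∀ i, 0 ≤ q₀ i) (hq₀ : Summable q₀) (hq0 : ∀ i, 0 ≤ q i) (hq : Summable q)
    (hqt : Summable fun n => ∑' t, q (t + n))
    (hbare : ∀ K, (gibbsK F ℰp γ K).real {U | ¬ PlaqSmall (θBal F.L γ b₀ p₀ K) U} ≤ q₀ K)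
    (hfb : ∀ K j, 1 ≤ j → j + 2 ≤ K → (gibbsK F ℰp γ K).real
      ({U | ¬ PlaqSmall (θBal F.L γ b₀ p₀ (K - j))
          (Averaging.iter (fun i => BlockAveraging.blockAvg (P := F.P K) (j := i) ℰp) j U)} ∩
        {U | ∀ i, i < j → PlaqSmall (θBal F.L γ b₀ p₀ (K - i))
          (Averaging.iter (fun i' => BlockAveraging.blockAvg (P := F.P K) (j := i') ℰp) i U)}) ≤ q (K - j)) :
    HistoryTailAt F γ b₀ p₀ m := by
  classical
  have hT0 : ∀ n, 0 ≤ ∑' t, q (t + n) := fun n => tsum_nonneg fun _ => hq0 _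
  -- one run `K` with `n ≥ 2` free top steps
  have hrun : ∀ K n, 2 ≤ n →
      (gibbsK F ℰp γ K).real (histGood F ℰp (θBal F.L γ b₀ p₀) K n)ᶜ ≤ q₀ K + ∑' t, q (t + n) := by
    intro K n hn
    haveI := isProbabilityMeasure_gibbsK F ℰp hγ K
    by_cases hnK : n ≤ K
    · refine (real_compl_histGood_le_sum_finestBad F ℰp (θBal F.L γ b₀ p₀) K n (gibbsK F ℰp γ K)).trans ?_
      rw [Finset.sum_range_succ', add_comm]
      refine add_le_add ?_ ?_
      · exact (measureReal_mono Set.inter_subset_left (measure_ne_top _ _)).trans (hbare K)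
      · calc ∑ j ∈ Finset.range (K - n), (gibbsK F ℰp γ K).real
              ({U | ¬ PlaqSmall (θBal F.L γ b₀ p₀ (K - (j + 1)))
                  (Averaging.iter (fun i => BlockAveraging.blockAvg (P := F.P K) (j := i) ℰp) (j + 1) U)} ∩
                {U | ∀ i, i < j + 1 → PlaqSmall (θBal F.L γ b₀ p₀ (K - i))
                  (Averaging.iter (fun i' => BlockAveraging.blockAvg (P := F.P K) (j := i') ℰp) i U)})
            ≤ ∑ j ∈ Finset.range (K - n), q (K - (j + 1)) :=
              Finset.sum_le_sum fun j hj => hfb K (j + 1) (by omega)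
                (by have := Finset.mem_range.mp hj; omega)
          _ = ∑ j ∈ Finset.range (K - n), q (j + n) := by
              rw [← Finset.sum_range_reflect (fun j => q (j + n)) (K - n)]
              refine Finset.sum_congr rfl fun j hj => ?_
              have := Finset.mem_range.mp hj
              show q (K - (j + 1)) = q (K - n - 1 - j + n)
              congr 1
              omega
          _ ≤ ∑' t, q (t + n) := ((summable_nat_add_iff n).mpr hq).sum_le_tsum _ fun _ _ => hq0 _
    · rw [histGood_of_lt F ℰp (not_le.mp hnK), Set.compl_univ, measureReal_empty]
      exact add_nonneg (hq₀0 K) (hT0 n)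
  -- the profile
  refine ⟨fun K => (if K < 2 * m then (1 : ℝ) else 0) + (q₀ K + q₀ (K + 1) + ∑' t, q (t + K / m)), ?_, fun K => ?_⟩
  · refine Summable.add ?_ ((hq₀.add ((summable_nat_add_iff 1).mpr hq₀)).add
      (summable_comp_div (T := fun n => ∑' t, q (t + n)) hT0 hqt hm))
    exact summable_of_ne_finset_zero (s := Finset.range (2 * m)) fun K hK =>
      if_neg (by rwa [Finset.mem_range] at hK)
  · beta_reduce
    have hrest : 0 ≤ q₀ K + q₀ (K + 1) + ∑' t, q (t + K / m) :=
      add_nonneg (add_nonneg (hq₀0 _) (hq₀0 _)) (hT0 _)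
    by_cases hK : K < 2 * m
    · rw [if_pos hK]
      haveI := isProbabilityMeasure_gibbsK F ℰp hγ K
      haveI := isProbabilityMeasure_gibbsK F ℰp hγ (K + 1)
      exact ⟨measureReal_le_one.trans (le_add_of_nonneg_right hrest),
        measureReal_le_one.trans (le_add_of_nonneg_right hrest)⟩
    · rw [if_neg hK, zero_add]
      have hn2 : 2 ≤ K / m := (Nat.le_div_iff_mul_le hm).mpr (by omega)
      constructor
      · exact (hrun K (K / m) hn2).trans (by linarith [hq₀0 (K + 1)])
      · exact (hrun (K + 1) (K / m) hn2).trans (by linarith [hq₀0 K])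

end Reduction

/-! ## §4 Arithmetic helpers: plaquette count and the geometric profile -/

section Arithmetic

/-- `#plaquettes of height j of the K-th approximation ≤ 9·(2L^{m+K−j})³ = 9·(8 L^{3m} (L^{K−j})³)` for `j ≤ K` (crude: `d² = 9` plane
labels per site) — adapted from the private `card_plaq_le`/`sitesPerDir_eq` of `T3AveragedTailProfile`. -/
theorem card_plaq_le_pow (F : T3Family) {K j : ℕ} (hj : j ≤ K) :
    (Fintype.card (Plaq (F.P K) j) : ℝ) ≤ 9 * (8 * (F.L : ℝ) ^ (3 * F.m) * ((F.L : ℝ) ^ (K - j)) ^ 3) := by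
  have hsites : (F.P K).sitesPerDir j = 2 * F.L ^ (F.m + (K - j)) := by
    show 2 * F.L ^ (F.m + K - j) = 2 * F.L ^ (F.m + (K - j))
    rw [show F.m + K - j = F.m + (K - j) by omega]
  have h1 : Fintype.card (Plaq (F.P K) j) =
      Fintype.card (Literature.MathematicalPhysics.QuantumFieldTheory.Plaquette 3 ((F.P K).sitesPerDir j)) :=
    Fintype.card_congr (plaqEquiv (P := F.P K) j)
  have h2 : Fintype.card (Literature.MathematicalPhysics.QuantumFieldTheory.Plaquette 3 ((F.P K).sitesPerDir j)) ≤
      ((F.P K).sitesPerDir j) ^ 3 * 3 ^ 2 := by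
    rw [Fintype.card_prod, Fintype.card_fun, ZMod.card, Fintype.card_fin]
    gcongr
    calc Fintype.card {p : Fin 3 × Fin 3 // p.1 < p.2} ≤ Fintype.card (Fin 3 × Fin 3) := Fintype.card_subtype_le _
      _ = 3 ^ 2 := by rw [Fintype.card_prod, Fintype.card_fin]; norm_num
  have hM : ((F.P K).sitesPerDir j : ℝ) ^ 3 = 8 * (F.L : ℝ) ^ (3 * F.m) * ((F.L : ℝ) ^ (K - j)) ^ 3 := by
    rw [hsites]; push_cast; ring
  rw [h1, ← hM]
  calc (Fintype.card (Literature.MathematicalPhysics.QuantumFieldTheory.Plaquette 3 ((F.P K).sitesPerDir j)) : ℝ)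
        ≤ (((F.P K).sitesPerDir j) ^ 3 * 3 ^ 2 : ℕ) := by exact_mod_cast h2
    _ = 9 * ((F.P K).sitesPerDir j : ℝ) ^ 3 := by push_cast; ring

/-- The per-height arithmetic of the tree (`T3AveragedTailProfile.perHeight_bound`) with its explicit constant packaged existentially:
for `0 < γ ≤ 1`, `0 < b₀`, `1 ≤ p₀`, `C ≥ 0`, `c > 0` there is `A' ≥ 0` with `9·(8L^{3m}(L^i)³)·Cβ_i^A e^{−c p(g_i)²} ≤ A'·2^{−i}` for all `i`. -/
theorem exists_perHeight_bound (F : T3Family) {γ b₀ p₀ : ℝ} (hγ : 0 < γ) (hγ1 : γ ≤ 1) (hb₀ : 0 < b₀) (hp₀ : 1 ≤ p₀)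
    {C : ℝ} (hC : 0 ≤ C) (A : ℕ) {c : ℝ} (hc : 0 < c) :
    ∃ A' : ℝ, 0 ≤ A' ∧ ∀ i : ℕ,
      (9 * (8 * (F.L : ℝ) ^ (3 * F.m) * ((F.L : ℝ) ^ i) ^ 3)) *
          (C * (F.scheme ℰp γ).β i ^ A *
            Real.exp (-(c * B10.pFun b₀ p₀ (Real.sqrt (γ * ((F.L : ℝ)⁻¹) ^ i)) ^ 2))) ≤
        A' * ((1 : ℝ) / 2) ^ i := by
  refine ⟨_, ?_, fun i => perHeight_bound F hγ hγ1 hb₀ hp₀ hC A hc i⟩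
  positivity

/-- The geometric profile `q(i) = A'·2^{−i}` (`A' ≥ 0`) is non-negative, summable, and has summable tail sums
(`Σ'_t q(t+n) = 2A'·2^{−n}`). -/
theorem geometric_profile {A' : ℝ} (hA' : 0 ≤ A') :
    (∀ i : ℕ, 0 ≤ A' * ((1 : ℝ) / 2) ^ i) ∧ Summable (fun i : ℕ => A' * ((1 : ℝ) / 2) ^ i) ∧
      Summable (fun n : ℕ => ∑' t : ℕ, A' * ((1 : ℝ) / 2) ^ (t + n)) := by
  refine ⟨fun i => by positivity, (summable_geometric_of_lt_one (by norm_num) (by norm_num)).mul_left A', ?_⟩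
  have heq : (fun n : ℕ => ∑' t : ℕ, A' * (1 / 2 : ℝ) ^ (t + n)) = fun n => (2 * A') * (1 / 2 : ℝ) ^ n := by
    funext n
    have h1 : (fun t : ℕ => A' * (1 / 2 : ℝ) ^ (t + n)) = fun t => (A' * (1 / 2 : ℝ) ^ n) * (1 / 2 : ℝ) ^ t := by
      funext t; rw [pow_add]; ring
    rw [h1, tsum_mul_left, tsum_geometric_two]; ring
  rw [heq]
  exact (summable_geometric_of_lt_one (by norm_num) (by norm_num)).mul_left (2 * A')

/-- Elementary: `card ≤ N`, `X_T, X_W ≥ 0`, `N·X_T ≤ A'_T r`, `N·X_W ≤ A'_W r` ⇒ `card·(X_T + X_W) ≤ (A'_T + A'_W)·r`. -/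
theorem level_arith {card N XT XW AT AW r : ℝ} (hcard : card ≤ N) (hXT : 0 ≤ XT) (hXW : 0 ≤ XW)
    (hT : N * XT ≤ AT * r) (hW : N * XW ≤ AW * r) : card * (XT + XW) ≤ (AT + AW) * r := by
  have h1 : card * (XT + XW) ≤ N * (XT + XW) := mul_le_mul_of_nonneg_right hcard (add_nonneg hXT hXW)
  linarith

end Arithmetic

end HistoryTailOfTwoSided

open HistoryTailOfTwoSided

/-! ## §5 The item -/

/-- **THE GLUE `HistoryTailOfTwoSided` OF ROUTE `FibreConvexityTail` (support item stmt-QuantumFields-25569), PROVED**: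
`TwoSidedTailL → TowerTailL →` the body of the parent crux `UnitScaleTilt.HistoryTailL` — for every block size `L` and floor `(b₁, p₁)`
there is a profile `(b₀, p₀)` above it (`b₀ = max b₁ (max bmin_T (max bmin_W 1))`, `p₀ = max p₁ 3`) such that for every `m ≥ 1` some
`γ₁ > 0` (`= min γ_T γ_W`) makes `HistoryTailAt F γ b₀ p₀ m` hold for every family of block size `L` and every `0 < γ ≤ γ₁`.  Proof: the
finest-bad-level decomposition (§1), the split by the conditioner two levels up into the (T)- and (W)-events (§2), the landed bare tail
`T3BareTailProfile.bareTailAt` and per-height arithmetic `T3AveragedTailProfile.perHeight_bound`, and the reduction §3.  Nothing here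
proves either tail crux, the rung R3, or anything about the mass gap. -/
theorem fibreConvexityTail_historyTailOfTwoSided_proof :
    Summit.QuantumFields.YangMills.Theses.FibreConvexityTail.HistoryTailOfTwoSided := by
  intro hT hW L b₁ p₁
  obtain ⟨bT, hbT⟩ := hT L
  obtain ⟨bW, hbW⟩ := hW L
  -- the profile above the floor and above both thresholds
  obtain ⟨b₀, hb₁, hbT', hbW', hb₀1⟩ : ∃ b₀ : ℝ, b₁ ≤ b₀ ∧ bT ≤ b₀ ∧ bW ≤ b₀ ∧ 1 ≤ b₀ :=
    ⟨max b₁ (max bT (max bW 1)), le_max_left _ _, le_max_of_le_right (le_max_left _ _),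
      le_max_of_le_right (le_max_of_le_right (le_max_left _ _)),
      le_max_of_le_right (le_max_of_le_right (le_max_right _ _))⟩
  obtain ⟨p₀, hp₁, hp₀⟩ : ∃ p₀ : ℝ, p₁ ≤ p₀ ∧ 2 < p₀ :=
    ⟨max p₁ 3, le_max_left _ _, lt_of_lt_of_le (by norm_num) (le_max_right _ _)⟩
  have hb₀ : 0 < b₀ := one_pos.trans_le hb₀1
  have hp₀1 : 1 ≤ p₀ := by linarith
  refine ⟨b₀, p₀, hb₁, hp₁, hb₀, hp₀, fun m hm => ?_⟩
  obtain ⟨γT, hγT, hγT1, hTF⟩ := hbT b₀ p₀ hbT' hb₀ hp₀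
  obtain ⟨γW, hγW, -, hWF⟩ := hbW b₀ p₀ hbW' hb₀ hp₀
  refine ⟨min γT γW, lt_min hγT hγW, fun F γ hFL hγ hγle => ?_⟩
  have hγ1 : γ ≤ 1 := hγle.trans ((min_le_left _ _).trans hγT1)
  obtain ⟨CT, AT, cT, hCT, hcT, hTb⟩ := hTF F γ hFL hγ (hγle.trans (min_le_left _ _))
  obtain ⟨CW, AW, cW, hCW, hcW, hWb⟩ := hWF F γ hFL hγ (hγle.trans (min_le_right _ _))
  -- the bare profile (landed: reflection positivity + chessboard) and the per-height constants
  obtain ⟨q₀, hq₀0, hq₀, -, hbare⟩ := bareTailAt F hγ hγ1 hb₀ hp₀1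
  obtain ⟨A'T, hA'T0, hPT⟩ := exists_perHeight_bound F hγ hγ1 hb₀ hp₀1 hCT AT hcT
  obtain ⟨A'W, hA'W0, hPW⟩ := exists_perHeight_bound F hγ hγ1 hb₀ hp₀1 hCW AW hcW
  obtain ⟨hq0, hq, hqt⟩ := geometric_profile (add_nonneg hA'T0 hA'W0)
  refine historyTailAt_of_bare_finestBad F hγ.le b₀ p₀ hm q₀ (fun i => (A'T + A'W) * ((1 : ℝ) / 2) ^ i)
    hq₀0 hq₀ hq0 hq hqt hbare fun K j hj1 hjK => ?_
  -- one height `1 ≤ j`, `j + 2 ≤ K`: union over plaquettes, split by the conditioner, (T) + (W), arithmetic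
  haveI := isProbabilityMeasure_gibbsK F ℰp hγ.le K
  refine (real_not_plaqSmall_inter_le_sum_split (gibbsK F ℰp γ K)
    (Averaging.iter (fun i' => BlockAveraging.blockAvg (P := F.P K) (j := i') ℰp) j) (θBal F.L γ b₀ p₀ (K - j))
    {U | ∀ i, i < j → PlaqSmall (θBal F.L γ b₀ p₀ (K - i))
      (Averaging.iter (fun i' => BlockAveraging.blockAvg (P := F.P K) (j := i') ℰp) i U)}
    (fun U => PlaqSmall (θBal F.L γ b₀ p₀ (K - (j + 2)))
      (Averaging.iter (fun i' => BlockAveraging.blockAvg (P := F.P K) (j := i') ℰp) (j + 2) U))).trans ?_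
  refine (Finset.sum_le_sum fun a _ => add_le_add (hTb K j hj1 hjK a) (hWb K j hj1 hjK a)).trans ?_
  rw [Finset.sum_const, Finset.card_univ, nsmul_eq_mul]
  exact level_arith (card_plaq_le_pow F (by omega))
    (mul_nonneg (mul_nonneg hCT (pow_nonneg (F.scheme_β_nonneg ℰp hγ.le (K - j)) AT)) (Real.exp_nonneg _))
    (mul_nonneg (mul_nonneg hCW (pow_nonneg (F.scheme_β_nonneg ℰp hγ.le (K - j)) AW)) (Real.exp_nonneg _))
    (hPT (K - j)) (hPW (K - j))

end Summit.QuantumFields.YangMills.Theorems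

end
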